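import Literature.NumberTheory.LFunctions.XiHigherDerivativesZeroCountingFunction
import HarnessLib

/-!
# Simple zeros of `ξ^{(m)}` on the critical line: at least `(2κ − 1) N(T)` of them, unconditionally

RH-FREE (every statement below is an unconditional theorem of this tree; nothing here bears on the
truth of RH). Topic `Literature/NumberTheory/LFunctions`, namespace `Literature.NumberTheory.LFunctions`
(helpers in `XiDerivSimple`). PROOF LAYER for `XiDerivativeZeros.lean` / `CriticalLineTwoThirds.lean`
([AF26] Remark 7.1, claim `AlpogeFurman2026_xiDeriv_simple_critical_dyadic`: `85.838 %` of the zeros of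
`ξ′` are simple and on the line) and for J. B. Conrey, *Zeros of derivatives of Riemann's xi-function on
the critical line. II*, J. Number Theory **17** (1983) 71–75 (key `Conrey1983II`), Corollary 1 (p. 72):
with `β_m` the proportion of zeros of `ξ^{(m)}` which are on `σ = ½` AND SIMPLE, `β₀ > 0.3485`,
`β₁ > 0.7869`, `β₂ > 0.9314`, `β₃ > 0.9666`, `β₄ > 0.9799`, `β₅ > 0.9863` (Levinson's method with a new
identity). Those constants are NOT proved here. What IS proved is the weak but unconditional and
uniform-in-`m` bound obtained from ANY cumulative proportion `κ` of simple critical zeros of `ζ` by an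
elementary WEIGHTED Rolle count (this tree; the printed sources argue differently):

* between consecutive distinct critical zeros of `ξ^{(m)}` there is a critical zero of `ξ^{(m+1)}`
  (Rolle for the real function `Ξ^{(m)}`); the Rolle points are distinct, and each one that is NOT simple
  has multiplicity `≥ 2`; summing multiplicities (`XiDerivSimple.sum_order_le_xiDerivZeroCount`):
  **`2 · #{distinct critical zeros of ξ^{(m)} up to T} ≤ S^{(m+1)}(T) + N^{(m+1)}(T) + 2`**
  (`XiDerivSimple.two_mul_ncard_criticalBox_le`), `S^{(m+1)}(T)` the number of SIMPLE critical zeros of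
  `ξ^{(m+1)}` with `0 < Im s ≤ T`;
* with `#{distinct critical zeros of ξ^{(m)}} ≥ N₀ˢ(T) − m` (`m`-fold Rolle from the simple critical zeros
  of `ζ`, `XiHigherDerivativesCriticalZeros.lean`) and Conrey's Lemma 2 `N^{(m+1)}(T) = N(T) + O(log T)`
  (`XiHigherDerivativesZeroCountingFunction.lean`): if `(κ − ε) N(T) ≤ N₀ˢ(T)` eventually for every
  `ε > 0`, then **`(2κ − 1 − ε) N(T) ≤ S^{(m+1)}(T)`** and `(2κ − 1 − ε) N^{(m+1)}(T) ≤ S^{(m+1)}(T)`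
  eventually (`eventually_mul_zetaZeroCount_le_xiDerivSimpleCritical`, `…_xiDerivZeroCount_le_…`);
* [AF26] Theorem A (i) (`κ = ⅔`, kernel theorem `AlpogeFurman2026_simple_critical_holds`) gives
  **`(1/3 − ε) N(T)` simple critical zeros of `ξ^{(m)}` for every `m ≥ 1`**, and its Montgomery–Taylor
  form (`κ = 2 − c_MT⁻¹ ≥ 0.6725`) gives **`(0.345 − ε) N(T)`**
  (`eventually_one_third_mul_le_xiDerivSimpleCritical`, `eventually_0345_mul_le_xiDerivSimpleCritical`).

AI-produced formalisation (literature-prover-rh-lit-frontier-1-g12-0, 2026-08-27); AI review is weaker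
than expert review. No endorsement of any preprint is implied.
-/

noncomputable section

open Complex Filter Set
open scoped Real Topology

namespace Literature.NumberTheory.LFunctions

open XiDerivCritical

namespace XiDerivSimple

/-- **Summing multiplicities over distinct zeros**: for a finite set `S` of zeros of `ξ^{(m)}` in the box,
`Σ_{s ∈ S} mult(s) ≤ N^{(m)}(T)`. [cite: Conrey1983, §1 (p. 49)] -/
theorem sum_order_le_xiDerivZeroCount (m : ℕ) {T : ℝ} (S : Finset ℂ)
    (hS : (S : Set ℂ) ⊆ xiDerivZeroBox m T) :
    ∑ s ∈ S, (analyticOrderAt (iteratedDeriv m riemannXi) s).toNat ≤ xiDerivZeroCount m T := by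
  classical
  have hB := xiDerivZeroBox_finite m T
  unfold xiDerivZeroCount
  rw [finsum_mem_eq_finite_toFinset_sum _ hB]
  exact Finset.sum_le_sum_of_subset fun s hs ↦ (Set.Finite.mem_toFinset hB).2 (hS hs)

/-- **Weighted Rolle count.** Twice the number of distinct critical zeros of `ξ^{(m)}` with ordinates in
`(0, T]` is at most `S^{(m+1)}(T) + N^{(m+1)}(T) + 2`, where `S^{(m+1)}(T)` counts the SIMPLE critical
zeros of `ξ^{(m+1)}` with `0 < Im s ≤ T` and `N^{(m+1)}(T)` all zeros of `ξ^{(m+1)}` there with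
multiplicity: between consecutive critical zeros of `ξ^{(m)}` lies a critical zero of `ξ^{(m+1)}`, simple
or of multiplicity `≥ 2`. [cite: Conrey1983II, Corollary 1 (p. 72)] -/
theorem two_mul_ncard_criticalBox_le (m : ℕ) (T : ℝ) :
    2 * {s ∈ xiDerivZeroBox m T | s.re = 1 / 2}.ncard ≤
      {s ∈ xiDerivZeroBox (m + 1) T |
          s.re = 1 / 2 ∧ analyticOrderAt (iteratedDeriv (m + 1) riemannXi) s = 1}.ncard +
        xiDerivZeroCount (m + 1) T + 2 := by
  classical
  set C : Set ℂ := {s ∈ xiDerivZeroBox m T | s.re = 1 / 2} with hC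
  have hCfin : C.Finite := criticalBox_finite m T
  have hinjOn : InjOn Complex.im C := by
    intro ρ hρ ρ' hρ' h
    exact Complex.ext (by rw [hρ.2, hρ'.2]) h
  set tF : Finset ℝ := hCfin.toFinset.image Complex.im with htF
  set k : ℕ := tF.card with hk
  have hcardC : C.ncard = k := by
    rw [hk, htF, Finset.card_image_of_injOn (by
      intro ρ hρ ρ' hρ' h
      exact hinjOn ((Set.Finite.mem_toFinset hCfin).1 hρ)
        ((Set.Finite.mem_toFinset hCfin).1 hρ') h), Set.ncard_eq_toFinset_card C hCfin]
  rw [hcardC]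
  have hmem : ∀ u ∈ tF, iteratedDeriv m riemannXi (1 / 2 + (u : ℂ) * I) = 0 ∧ 0 < u ∧ u ≤ T := by
    intro u hu
    rw [htF, Finset.mem_image] at hu
    obtain ⟨ρ, hρ, rfl⟩ := hu
    rw [Set.Finite.mem_toFinset] at hρ
    have hρeq : (1 / 2 : ℂ) + (ρ.im : ℂ) * I = ρ := by
      apply Complex.ext <;> simp [hρ.2]
    rw [hρeq]
    exact ⟨hρ.1.1, hρ.1.2.1, hρ.1.2.2⟩
  set t : Fin k ↪o ℝ := tF.orderEmbOfFin hk.symm with ht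
  have htmem : ∀ j : Fin k, t j ∈ tF := fun j ↦ by
    rw [ht]
    exact Finset.orderEmbOfFin_mem tF hk.symm j
  have htmono : StrictMono t := t.strictMono
  rcases Nat.lt_or_ge k 2 with hk2 | hk2
  · omega
  have hrolle : ∀ j : Fin (k - 1), ∃ c : ℝ,
      t ⟨j.1, by omega⟩ < c ∧ c < t ⟨j.1 + 1, by omega⟩ ∧
        iteratedDeriv (m + 1) riemannXi (1 / 2 + (c : ℂ) * I) = 0 := by
    intro j
    have hlt : t ⟨j.1, by omega⟩ < t ⟨j.1 + 1, by omega⟩ :=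
      htmono (Fin.mk_lt_mk.2 (Nat.lt_succ_self _))
    obtain ⟨c, hc, hc0⟩ := exists_iteratedDeriv_succ_critical_zero_between m hlt
      (hmem _ (htmem _)).1 (hmem _ (htmem _)).1
    exact ⟨c, hc.1, hc.2, hc0⟩
  choose c hc_lo hc_hi hc_zero using hrolle
  have hcmono : StrictMono c := by
    intro i j hij
    have hij' : i.1 < j.1 := hij
    calc c i < t ⟨i.1 + 1, by omega⟩ := hc_hi i
      _ ≤ t ⟨j.1, by omega⟩ := htmono.monotone (Fin.mk_le_mk.2 (by omega))
      _ < c j := hc_lo j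
  set pt : Fin (k - 1) → ℂ := fun j ↦ (1 / 2 : ℂ) + (c j : ℂ) * I with hpt
  have hinj : Function.Injective pt := by
    intro i j hij
    have him := congrArg Complex.im hij
    simp only [hpt, add_im, mul_im, ofReal_re, I_im, mul_one, ofReal_im, I_re, mul_zero, add_zero]
      at him
    have h12 : ((1 / 2 : ℂ)).im = 0 := by norm_num
    rw [h12, zero_add, zero_add] at him
    exact hcmono.injective him
  have hptmem : ∀ j, pt j ∈ {s ∈ xiDerivZeroBox (m + 1) T | s.re = 1 / 2} := by
    intro j
    have him : (pt j).im = c j := by simp [hpt]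
    have hre : (pt j).re = 1 / 2 := by simp [hpt]
    have hpos : 0 < c j := by
      have h0 : 0 < t ⟨j.1, by omega⟩ := (hmem _ (htmem _)).2.1
      linarith [hc_lo j]
    have hle : c j ≤ T := by
      have h1 : t ⟨j.1 + 1, by omega⟩ ≤ T := (hmem _ (htmem _)).2.2
      linarith [hc_hi j]
    refine ⟨⟨hc_zero j, ?_, ?_⟩, hre⟩
    · rw [him]; exact hpos
    · rw [him]; exact hle
  -- the Rolle points as a Finset, split by simplicity
  set P : Finset ℂ := Finset.univ.image pt with hP
  have hPcard : P.card = k - 1 := by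
    rw [hP, Finset.card_image_of_injective _ hinj, Finset.card_univ, Fintype.card_fin]
  have hPsub : (P : Set ℂ) ⊆ xiDerivZeroBox (m + 1) T := by
    intro s hs
    rw [Finset.mem_coe, hP, Finset.mem_image] at hs
    obtain ⟨j, -, rfl⟩ := hs
    exact (hptmem j).1
  have hsum := sum_order_le_xiDerivZeroCount (m + 1) P hPsub
  set P₁ : Finset ℂ := P.filter fun s ↦ analyticOrderAt (iteratedDeriv (m + 1) riemannXi) s = 1 with hP₁
  set P₂ : Finset ℂ := P.filter fun s ↦ ¬analyticOrderAt (iteratedDeriv (m + 1) riemannXi) s = 1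
    with hP₂
  have hsplit : ∑ s ∈ P, (analyticOrderAt (iteratedDeriv (m + 1) riemannXi) s).toNat =
      ∑ s ∈ P₁, (analyticOrderAt (iteratedDeriv (m + 1) riemannXi) s).toNat +
        ∑ s ∈ P₂, (analyticOrderAt (iteratedDeriv (m + 1) riemannXi) s).toNat :=
    (Finset.sum_filter_add_sum_filter_not P _ _).symm
  have hcard12 : P₁.card + P₂.card = P.card := Finset.card_filter_add_card_filter_not _
  have h1 : P₁.card ≤ ∑ s ∈ P₁, (analyticOrderAt (iteratedDeriv (m + 1) riemannXi) s).toNat := by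
    rw [Finset.card_eq_sum_ones]
    refine Finset.sum_le_sum fun s hs ↦ ?_
    rw [hP₁, Finset.mem_filter] at hs
    rw [hs.2]
    rfl
  have h2 : 2 * P₂.card ≤ ∑ s ∈ P₂, (analyticOrderAt (iteratedDeriv (m + 1) riemannXi) s).toNat := by
    rw [Finset.card_eq_sum_ones, Finset.mul_sum]
    refine Finset.sum_le_sum fun s hs ↦ ?_
    rw [hP₂, Finset.mem_filter] at hs
    have hzero : iteratedDeriv (m + 1) riemannXi s = 0 := (hPsub hs.1).1
    have hge := one_le_analyticOrderAt_toNat (m + 1) hzero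
    have hne : (analyticOrderAt (iteratedDeriv (m + 1) riemannXi) s).toNat ≠ 1 := by
      intro h1'
      apply hs.2
      have hnt := analyticOrderAt_ne_top (m + 1) s
      obtain ⟨n, hn⟩ := ENat.ne_top_iff_exists.mp hnt
      rw [← hn] at h1' ⊢
      rw [ENat.toNat_coe] at h1'
      rw [h1']
      rfl
    omega
  -- the simple Rolle points are simple critical zeros of `ξ^{(m+1)}` in the box
  have hP₁sub : (P₁ : Set ℂ) ⊆ {s ∈ xiDerivZeroBox (m + 1) T |
      s.re = 1 / 2 ∧ analyticOrderAt (iteratedDeriv (m + 1) riemannXi) s = 1} := by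
    intro s hs
    rw [Finset.mem_coe, hP₁, Finset.mem_filter] at hs
    have hs' := hs.1
    rw [hP, Finset.mem_image] at hs'
    obtain ⟨j, -, rfl⟩ := hs'
    exact ⟨(hptmem j).1, (hptmem j).2, hs.2⟩
  have hSfin : {s ∈ xiDerivZeroBox (m + 1) T |
      s.re = 1 / 2 ∧ analyticOrderAt (iteratedDeriv (m + 1) riemannXi) s = 1}.Finite :=
    (xiDerivZeroBox_finite (m + 1) T).subset (sep_subset _ _)
  have hP₁le : P₁.card ≤ {s ∈ xiDerivZeroBox (m + 1) T |
      s.re = 1 / 2 ∧ analyticOrderAt (iteratedDeriv (m + 1) riemannXi) s = 1}.ncard := by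
    rw [← Set.ncard_coe_finset]
    exact Set.ncard_le_ncard hP₁sub hSfin
  omega

end XiDerivSimple

/-! ## `(2κ − 1 − ε) N(T)` simple critical zeros of `ξ^{(m+1)}`, from a simple-critical proportion `κ` of `ζ` -/

/-- **From a cumulative proportion `κ` of simple critical zeros of `ζ` to simple critical zeros of
`ξ^{(m+1)}`**: if `(κ − ε) N(T) ≤ N₀ˢ(T)` eventually for every `ε > 0`, then for every `ε > 0`,
eventually `(2κ − 1 − ε) N(T) ≤ S^{(m+1)}(T)`, the number of simple zeros of `ξ^{(m+1)}` on the critical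
line with `0 < Im s ≤ T` (weighted Rolle count + `m`-fold Rolle + Conrey's Lemma 2). The printed
proportions `β_m` (Conrey 1983 II, Cor. 1) are NOT proved here. [cite: Conrey1983II, Corollary 1 (p. 72)] -/
theorem eventually_mul_zetaZeroCount_le_xiDerivSimpleCritical (m : ℕ) {κ : ℝ}
    (h : ∀ ε : ℝ, 0 < ε → ∀ᶠ T : ℝ in atTop, (κ - ε) * (zetaZeroCount T : ℝ) ≤ simpleCriticalZeroCount T)
    (ε : ℝ) (hε : 0 < ε) :
    ∀ᶠ T : ℝ in atTop, (2 * κ - 1 - ε) * (zetaZeroCount T : ℝ) ≤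
      ({s ∈ xiDerivZeroBox (m + 1) T |
          s.re = 1 / 2 ∧ analyticOrderAt (iteratedDeriv (m + 1) riemannXi) s = 1}.ncard : ℝ) := by
  obtain ⟨C, T₀, hT₀, hC⟩ := exists_abs_xiDerivZeroCount_sub_zetaZeroCount_le_log_all (m + 1)
  have hA := h (ε / 4) (by positivity)
  have hmain := AlpogeFurman2026.eventually_zetaZeroCount_near_main (1 / 2) (by norm_num)
  have hNlim : Tendsto (fun T : ℝ ↦ (zetaZeroCount T : ℝ)) atTop atTop :=
    tendsto_natCast_atTop_atTop.comp tendsto_zetaZeroCount_atTop_holds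
  have hm0 : (0 : ℝ) ≤ m := Nat.cast_nonneg _
  filter_upwards [hA, hmain, eventually_ge_atTop T₀, eventually_gt_atTop (1 : ℝ),
    eventually_ge_atTop (16 * Real.pi * |C| / ε), hNlim.eventually_ge_atTop ((8 * m + 8) / ε)]
    with T hAT hN hT hT1 hTC hNε
  have hπ := Real.pi_pos
  have hL : 0 < Real.log T := Real.log_pos hT1
  -- the weighted Rolle count and the `m`-fold Rolle transfer, in `ℝ`
  have hW : (2 : ℝ) * ({s ∈ xiDerivZeroBox m T | s.re = 1 / 2}.ncard : ℝ) ≤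
      ({s ∈ xiDerivZeroBox (m + 1) T |
          s.re = 1 / 2 ∧ analyticOrderAt (iteratedDeriv (m + 1) riemannXi) s = 1}.ncard : ℝ) +
        xiDerivZeroCount (m + 1) T + 2 := by
    exact_mod_cast XiDerivSimple.two_mul_ncard_criticalBox_le m T
  have hR : (simpleCriticalZeroCount T : ℝ) ≤ ({s ∈ xiDerivZeroBox m T | s.re = 1 / 2}.ncard : ℝ) + m := by
    have hsub : {ρ ∈ zetaZeroBox (1 / 2) T | ρ.re = 1 / 2 ∧ riemannZetaZeroOrder ρ = 1} ⊆
        {ρ ∈ zetaZeroBox (1 / 2) T | ρ.re = 1 / 2} := fun ρ hρ ↦ ⟨hρ.1, hρ.2.1⟩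
    have h1 : simpleCriticalZeroCount T ≤ {s ∈ xiDerivZeroBox m T | s.re = 1 / 2}.ncard + m :=
      calc simpleCriticalZeroCount T
          ≤ {ρ ∈ zetaZeroBox (1 / 2) T | ρ.re = 1 / 2}.ncard :=
            Set.ncard_le_ncard hsub (criticalZeroSet_finite T)
        _ ≤ {s ∈ xiDerivZeroBox 0 T | s.re = 1 / 2}.ncard :=
            Set.ncard_le_ncard (zeta_criticalZeros_subset T) (criticalBox_finite 0 T)
        _ ≤ {s ∈ xiDerivZeroBox m T | s.re = 1 / 2}.ncard + m := ncard_criticalBox_zero_le_add m T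
    exact_mod_cast h1
  -- Lemma 2: `N^{(m+1)} ≤ N + |C| log T ≤ N + (ε/4) N`
  have hb := hC T hT
  have hNmle : (xiDerivZeroCount (m + 1) T : ℝ) ≤ zetaZeroCount T + |C| * Real.log T := by
    have := (abs_le.1 (hb.trans (mul_le_mul_of_nonneg_right (le_abs_self C) hL.le))).2
    linarith
  have hNlow : (1 - 1 / 2) * (T / (2 * Real.pi) * Real.log T) ≤ zetaZeroCount T := hN.1
  have hClog : |C| * Real.log T ≤ ε / 4 * (zetaZeroCount T : ℝ) := by
    have h1 : |C| * Real.log T ≤ ε / 4 * ((1 - 1 / 2) * (T / (2 * Real.pi) * Real.log T)) := by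
      rw [div_le_iff₀ hε] at hTC
      have : |C| ≤ ε / 4 * ((1 - 1 / 2) * (T / (2 * Real.pi))) := by
        rw [show ε / 4 * ((1 - 1 / 2) * (T / (2 * Real.pi))) = ε * T / (16 * Real.pi) by ring,
          le_div_iff₀ (by positivity)]
        nlinarith
      nlinarith
    exact h1.trans (mul_le_mul_of_nonneg_left hNlow (by positivity))
  have hmN : 2 * (m : ℝ) + 2 ≤ ε / 4 * (zetaZeroCount T : ℝ) := by
    have := (div_le_iff₀ hε).1 hNε
    linarith
  linarith

/-- Relative form: **`(2κ − 1 − ε) N^{(m+1)}(T) ≤ S^{(m+1)}(T)`** eventually — a proportion `≥ 2κ − 1` of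
the zeros of `ξ^{(m+1)}` are simple and on the critical line. [cite: Conrey1983II, Corollary 1 (p. 72)] -/
theorem eventually_mul_xiDerivZeroCount_le_xiDerivSimpleCritical (m : ℕ) {κ : ℝ}
    (h : ∀ ε : ℝ, 0 < ε → ∀ᶠ T : ℝ in atTop, (κ - ε) * (zetaZeroCount T : ℝ) ≤ simpleCriticalZeroCount T)
    (ε : ℝ) (hε : 0 < ε) :
    ∀ᶠ T : ℝ in atTop, (2 * κ - 1 - ε) * (xiDerivZeroCount (m + 1) T : ℝ) ≤
      ({s ∈ xiDerivZeroBox (m + 1) T |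
          s.re = 1 / 2 ∧ analyticOrderAt (iteratedDeriv (m + 1) riemannXi) s = 1}.ncard : ℝ) := by
  rcases le_or_gt (2 * κ - 1 - ε) 0 with hneg | hpos
  · exact Filter.Eventually.of_forall fun T ↦ by
      have h0 : (0 : ℝ) ≤ ({s ∈ xiDerivZeroBox (m + 1) T |
          s.re = 1 / 2 ∧ analyticOrderAt (iteratedDeriv (m + 1) riemannXi) s = 1}.ncard : ℝ) :=
        Nat.cast_nonneg _
      have h1 : (0 : ℝ) ≤ xiDerivZeroCount (m + 1) T := Nat.cast_nonneg _
      nlinarith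
  -- `N^{(m+1)}/N → 1`: eventually `N^{(m+1)} ≤ (1 + δ) N` with `(2κ−1−ε/2)/(1+δ) ≥ 2κ−1−ε`
  have hA := eventually_mul_zetaZeroCount_le_xiDerivSimpleCritical m h (ε / 2) (by positivity)
  have hq := tendsto_xiDerivZeroCount_div_zetaZeroCount_all (m + 1)
  set δ : ℝ := (ε / 2) / (2 * κ - 1 - ε) with hδ
  have hδpos : 0 < δ := by positivity
  have hev : ∀ᶠ T : ℝ in atTop, (xiDerivZeroCount (m + 1) T : ℝ) / zetaZeroCount T < 1 + δ :=
    hq.eventually (gt_mem_nhds (by linarith))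
  have hmain := AlpogeFurman2026.eventually_zetaZeroCount_near_main (1 / 2) (by norm_num)
  filter_upwards [hA, hev, hmain, eventually_gt_atTop (1 : ℝ)] with T hAT hqT hN hT1
  have hπ := Real.pi_pos
  have hL : 0 < Real.log T := Real.log_pos hT1
  have hNpos : 0 < (zetaZeroCount T : ℝ) := by
    have : 0 < T / (2 * Real.pi) * Real.log T := by positivity
    linarith [hN.1]
  have hNm : (xiDerivZeroCount (m + 1) T : ℝ) ≤ (1 + δ) * zetaZeroCount T := by
    rw [div_lt_iff₀ hNpos] at hqT
    exact hqT.le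
  have hkey : (2 * κ - 1 - ε) * (1 + δ) = 2 * κ - 1 - ε / 2 := by
    rw [hδ]; field_simp; ring
  calc (2 * κ - 1 - ε) * (xiDerivZeroCount (m + 1) T : ℝ)
      ≤ (2 * κ - 1 - ε) * ((1 + δ) * zetaZeroCount T) := mul_le_mul_of_nonneg_left hNm hpos.le
    _ = (2 * κ - 1 - ε / 2) * zetaZeroCount T := by rw [← mul_assoc, hkey]
    _ ≤ _ := hAT

/-- **Unconditionally, for every `m ≥ 1`, at least `(1/3 − ε) N(T)` zeros of `ξ^{(m)}` with `0 < Im s ≤ T`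
are SIMPLE and ON the critical line** ([AF26] Theorem A (i): `⅔` of the zeros of `ζ` are simple and
critical). [cite: AlpogeFurman2026, Theorem A (i) and Remark 7.1] [cite: Conrey1983II, Corollary 1 (p. 72)] -/
theorem eventually_one_third_mul_le_xiDerivSimpleCritical (m : ℕ) (ε : ℝ) (hε : 0 < ε) :
    ∀ᶠ T : ℝ in atTop, (1 / 3 - ε) * (zetaZeroCount T : ℝ) ≤
      ({s ∈ xiDerivZeroBox (m + 1) T |
          s.re = 1 / 2 ∧ analyticOrderAt (iteratedDeriv (m + 1) riemannXi) s = 1}.ncard : ℝ) := by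
  have h := eventually_mul_zetaZeroCount_le_xiDerivSimpleCritical m
    AlpogeFurman2026_simple_critical_holds ε hε
  refine h.mono fun T hT ↦ ?_
  norm_num at hT ⊢
  linarith

/-- Relative form: for every `m ≥ 1`, a proportion `≥ 1/3 − ε` of the zeros of `ξ^{(m)}` up to height
`T` are simple and on the critical line, for all large `T`. [cite: AlpogeFurman2026, Theorem A (i) and Remark 7.1]
[cite: Conrey1983II, Corollary 1 (p. 72)] -/
theorem eventually_one_third_mul_xiDerivZeroCount_le_xiDerivSimpleCritical (m : ℕ) (ε : ℝ)
    (hε : 0 < ε) :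
    ∀ᶠ T : ℝ in atTop, (1 / 3 - ε) * (xiDerivZeroCount (m + 1) T : ℝ) ≤
      ({s ∈ xiDerivZeroBox (m + 1) T |
          s.re = 1 / 2 ∧ analyticOrderAt (iteratedDeriv (m + 1) riemannXi) s = 1}.ncard : ℝ) := by
  have h := eventually_mul_xiDerivZeroCount_le_xiDerivSimpleCritical m
    AlpogeFurman2026_simple_critical_holds ε hε
  refine h.mono fun T hT ↦ ?_
  norm_num at hT ⊢
  linarith

/-- **Montgomery–Taylor form: `(3 − 2 c_MT⁻¹ − ε) N(T) ≤ S^{(m+1)}(T)`** eventually, for every `m`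
(`3 − 2c_MT⁻¹ = 0.34501…`). [cite: AlpogeFurman2026, Theorem A (p. 1) and Remark 7.1]
[cite: Conrey1983II, Corollary 1 (p. 72)] -/
theorem eventually_mt_mul_le_xiDerivSimpleCritical (m : ℕ) (ε : ℝ) (hε : 0 < ε) :
    ∀ᶠ T : ℝ in atTop, (3 - 2 * montgomeryTaylorInvConstant - ε) * (zetaZeroCount T : ℝ) ≤
      ({s ∈ xiDerivZeroBox (m + 1) T |
          s.re = 1 / 2 ∧ analyticOrderAt (iteratedDeriv (m + 1) riemannXi) s = 1}.ncard : ℝ) := by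
  have h := eventually_mul_zetaZeroCount_le_xiDerivSimpleCritical m
    AlpogeFurman2026_simple_critical_MT_cumulative ε hε
  refine h.mono fun T hT ↦ ?_
  have e : 2 * (2 - montgomeryTaylorInvConstant) - 1 - ε = 3 - 2 * montgomeryTaylorInvConstant - ε := by
    ring
  rw [e] at hT
  exact hT

/-- Numerically: **for every `m ≥ 1`, at least `(0.345 − ε) N(T)` zeros of `ξ^{(m)}` up to height `T` are
simple and on the critical line**, and they are a proportion `≥ 0.345 − ε` of all zeros of `ξ^{(m)}` up
to `T` (Conrey 1983 II prints `β₁ > 0.7869`, `β₂ > 0.9314`, …; [AF26] Remark 7.1 claims `0.85838` for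
`ξ′` in dyadic windows — neither is proved here). [cite: Conrey1983II, Corollary 1 (p. 72)]
[cite: AlpogeFurman2026, Theorem A (p. 1) and Remark 7.1] -/
theorem eventually_0345_mul_le_xiDerivSimpleCritical (m : ℕ) (ε : ℝ) (hε : 0 < ε) :
    ∀ᶠ T : ℝ in atTop,
      (0.345 - ε) * (zetaZeroCount T : ℝ) ≤
          ({s ∈ xiDerivZeroBox (m + 1) T |
              s.re = 1 / 2 ∧ analyticOrderAt (iteratedDeriv (m + 1) riemannXi) s = 1}.ncard : ℝ) ∧
        (0.345 - ε) * (xiDerivZeroCount (m + 1) T : ℝ) ≤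
          ({s ∈ xiDerivZeroBox (m + 1) T |
              s.re = 1 / 2 ∧ analyticOrderAt (iteratedDeriv (m + 1) riemannXi) s = 1}.ncard : ℝ) := by
  have hκ : ∀ ε : ℝ, 0 < ε → ∀ᶠ T : ℝ in atTop,
      (0.6725 - ε) * (zetaZeroCount T : ℝ) ≤ simpleCriticalZeroCount T :=
    AlpogeFurman2026_simple_critical_MT_cumulative'
  have h1 := eventually_mul_zetaZeroCount_le_xiDerivSimpleCritical m hκ ε hε
  have h2 := eventually_mul_xiDerivZeroCount_le_xiDerivSimpleCritical m hκ ε hε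
  filter_upwards [h1, h2] with T hT1 hT2
  norm_num at hT1 hT2 ⊢
  exact ⟨hT1, hT2⟩

end Literature.NumberTheory.LFunctions

end
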